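import Summits.Ventures.PercRepro0.Decay

/-!
# The random set `𝒮` of SHARP §4 and Claim 5 (seat p4, block P5 in Lean: S2, part 1)

SHARP-p4-v2 §4 on `Defs`, the objects of Lemma 4.1:

* `boxF d n` = `Λ_n` and `intF d n` = `Λ_n ∖ ∂Λ_n` as finsets; `ToBdry n ω x` = «`x ↔_{Λ_n} ∂Λ_n`» (`x` is joined to
  `∂Λ_n` by an open path lying in `Λ_n`), with `{0 ↔ ∂Λ_n} = {0 ↔_{Λ_n} ∂Λ_n}` (`toBoundary_eq_toBdry`);
* `SEq n A` = `{𝒮 = A}` where `𝒮 = {x ∈ Λ_n : ¬ (x ↔_{Λ_n} ∂Λ_n)}` is the random set of SHARP §4; the candidate values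
  (`scands d n`) are the subsets of `Λ_n ∖ ∂Λ_n` (points of `∂Λ_n` are trivially joined to `∂Λ_n`); the events `{𝒮 = A}`
  partition the configurations (`exists_sEq`, `sEq_eq`, `P_eq_sum_sEq`) and `{0 ∈ 𝒮} = {0 ↔ ∂Λ_n}ᶜ`
  (`P_compl_toBoundary_eq_sum`);
* **Claim 5** (`sEq_iff`): for `A ⊆ Λ_n ∖ ∂Λ_n`, `𝒮 = A` iff every bond of `E(Λ_n)` from `A` to `Λ_n ∖ A` is closed and
  every `v ∈ Λ_n ∖ A` is joined to `∂Λ_n` inside `Λ_n ∖ A` (via the last-exit lemma `ClusterS.exists_exit`); hence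
  `{𝒮 = A}` is determined by the bonds of `Λ_n` not inside `A` (`determinedBy_sEq`).

Continued in `Pivotal.lean` (Claim 6, independence and Lemma 4.1).
-/

namespace Summit.Ventures.PercRepro0.Sharp

open MeasureTheory ProbabilityTheory unitInterval Set
open Summit.Ventures.PercRepro0.Defs
open scoped ENNReal Classical

variable {d : ℕ}


/-! ### The box and its interior as finsets; `x ↔_{Λ_n} ∂Λ_n` -/

/-- `Λ_n` as a finset. -/
noncomputable def boxF (d n : ℕ) : Finset (Vertex d) := (box_finite (d := d) n).toFinset

/-- Membership in `boxF`. -/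
theorem mem_boxF {n : ℕ} {x : Vertex d} : x ∈ boxF d n ↔ x ∈ box d n := Set.Finite.mem_toFinset _

/-- `x ↔_{Λ_n} ∂Λ_n`: `x` is joined to `∂Λ_n` by an open path lying in `Λ_n`. -/
def ToBdry (n : ℕ) (ω : Config d) (x : Vertex d) : Prop := ∃ z ∈ boundary d n, ConnIn (box d n) ω x z

/-- `{0 ↔ ∂Λ_n} = {0 ↔_{Λ_n} ∂Λ_n}`. -/
theorem toBoundary_eq_toBdry (n : ℕ) : toBoundary d n = {ω : Config d | ToBdry n ω 0} := by
  rw [toBoundary_eq_boxConn]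
  ext ω
  simp only [Set.mem_setOf_eq, ToBdry, conn_boxBonds_iff]

/-- Points of `∂Λ_n` are joined to `∂Λ_n`. -/
theorem toBdry_of_mem_boundary {n : ℕ} (ω : Config d) {z : Vertex d} (hz : z ∈ boundary d n) :
    ToBdry n ω z := ⟨z, hz, connIn_refl _ _ _⟩

/-- `{x ↔_{Λ_n} ∂Λ_n}` only depends on the bonds of `Λ_n`. -/
theorem toBdry_congr {n : ℕ} {ω ω' : Config d} (h : ∀ e ∈ bondsIn (box d n), (e ∈ ω ↔ e ∈ ω'))
    (x : Vertex d) : ToBdry n ω x ↔ ToBdry n ω' x :=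
  exists_congr fun z => and_congr_right fun _ => connIn_congr h x z

/-- The interior `Λ_n ∖ ∂Λ_n` as a finset. -/
noncomputable def intF (d n : ℕ) : Finset (Vertex d) := (boxF d n).filter fun x => x ∉ boundary d n

/-- Membership in the interior. -/
theorem mem_intF {n : ℕ} {x : Vertex d} : x ∈ intF d n ↔ x ∈ box d n ∧ x ∉ boundary d n := by
  rw [intF, Finset.mem_filter, mem_boxF]

/-! ### The random set `𝒮` and the events `{𝒮 = A}` -/

/-- `{𝒮 = A}`: the set of vertices of `Λ_n` not joined to `∂Λ_n` inside `Λ_n` is exactly `A`. -/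
def SEq (n : ℕ) (A : Finset (Vertex d)) : Set (Config d) :=
  {ω | ∀ x ∈ boxF d n, (¬ ToBdry n ω x ↔ x ∈ A)}

/-- The candidate values of `𝒮`: the subsets of `Λ_n ∖ ∂Λ_n`. -/
noncomputable def scands (d n : ℕ) : Finset (Finset (Vertex d)) := (intF d n).powerset

/-- `A ∈ scands d n` iff `A ⊆ Λ_n ∖ ∂Λ_n`. -/
theorem mem_scands {n : ℕ} {A : Finset (Vertex d)} : A ∈ scands d n ↔ A ⊆ intF d n :=
  Finset.mem_powerset

/-- Every configuration has its `𝒮` among the candidates. -/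
theorem exists_sEq (n : ℕ) (ω : Config d) : ∃ A ∈ scands d n, ω ∈ SEq n A := by
  refine ⟨(intF d n).filter fun x => ¬ ToBdry n ω x, mem_scands.2 (Finset.filter_subset _ _),
    fun x hx => ?_⟩
  rw [Finset.mem_filter, mem_intF]
  constructor
  · intro h
    exact ⟨⟨mem_boxF.1 hx, fun hb => h (toBdry_of_mem_boundary ω hb)⟩, h⟩
  · intro h
    exact h.2

/-- The value of `𝒮` is unique. -/
theorem sEq_eq {n : ℕ} {A A' : Finset (Vertex d)} (hA : A ⊆ intF d n) (hA' : A' ⊆ intF d n)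
    {ω : Config d} (h : ω ∈ SEq n A) (h' : ω ∈ SEq n A') : A = A' := by
  ext x
  by_cases hx : x ∈ boxF d n
  · rw [← h x hx, ← h' x hx]
  · exact ⟨fun hxA => absurd (mem_boxF.2 (mem_intF.1 (hA hxA)).1) hx,
      fun hxA => absurd (mem_boxF.2 (mem_intF.1 (hA' hxA)).1) hx⟩

/-- `x ∈ 𝒮 ⟺ ¬ (x ↔_{Λ_n} ∂Λ_n)`, for `x ∈ Λ_n`. -/
theorem mem_sEq_iff {n : ℕ} {A : Finset (Vertex d)} {ω : Config d} (h : ω ∈ SEq n A) {x : Vertex d}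
    (hx : x ∈ box d n) : x ∈ A ↔ ¬ ToBdry n ω x :=
  (h x (mem_boxF.2 hx)).symm

/-- `{𝒮 = A}` is determined by `E(Λ_n)`. -/
theorem determinedBy_sEq_bondsIn (n : ℕ) (A : Finset (Vertex d)) :
    DeterminedBy (bondsIn (box d n)) (SEq n A) := by
  intro ω ω' h
  show (∀ x ∈ boxF d n, (¬ ToBdry n ω x ↔ x ∈ A)) ↔ ∀ x ∈ boxF d n, (¬ ToBdry n ω' x ↔ x ∈ A)
  have : ∀ x, ToBdry n ω x ↔ ToBdry n ω' x := fun x => toBdry_congr h x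
  simp only [this]

/-- `{𝒮 = A}` is measurable. -/
theorem measurableSet_sEq (n : ℕ) (A : Finset (Vertex d)) : MeasurableSet (SEq n A) :=
  Russo.measurableSet_of_determinedBy (bondsIn_finite (box_finite n)) (determinedBy_sEq_bondsIn n A)

/-- `P(B) = ∑_A P({𝒮 = A} ∩ B)` over the candidates. -/
theorem P_eq_sum_sEq (n : ℕ) (p : I) {B : Set (Config d)} (hB : MeasurableSet B) :
    P d p B = ∑ A ∈ scands d n, P d p (SEq n A ∩ B) := by
  have hrepr : B = ⋃ A ∈ scands d n, (SEq n A ∩ B) := by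
    ext ω
    simp only [mem_iUnion, mem_inter_iff, exists_prop]
    constructor
    · intro hω
      obtain ⟨A, hA, hS⟩ := exists_sEq n ω
      exact ⟨A, hA, hS, hω⟩
    · rintro ⟨A, -, -, hω⟩
      exact hω
  conv_lhs => rw [hrepr]
  refine measure_biUnion_finset ?_ fun A _ => (measurableSet_sEq n A).inter hB
  intro A hA A' hA' hne
  simp only [Function.onFun]
  rw [Set.disjoint_left]
  rintro ω ⟨h1, -⟩ ⟨h2, -⟩
  exact hne (sEq_eq (mem_scands.1 hA) (mem_scands.1 hA') h1 h2)

/-- `P(0 ↔ ∂Λ_n)ᶜ = P(0 ∈ 𝒮) = ∑_{A ∋ 0} P(𝒮 = A)`. -/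
theorem P_compl_toBoundary_eq_sum (n : ℕ) (p : I) :
    P d p (toBoundary d n)ᶜ =
      ∑ A ∈ (scands d n).filter (fun A => (0 : Vertex d) ∈ A), P d p (SEq n A) := by
  have hrepr : (toBoundary d n)ᶜ = ⋃ A ∈ (scands d n).filter (fun A => (0 : Vertex d) ∈ A), SEq n A := by
    ext ω
    rw [toBoundary_eq_toBdry]
    simp only [mem_compl_iff, mem_setOf_eq, mem_iUnion, Finset.mem_filter, exists_prop]
    constructor
    · intro hω
      obtain ⟨A, hA, hS⟩ := exists_sEq n ω
      exact ⟨A, ⟨hA, (mem_sEq_iff hS (zero_mem_box n)).2 hω⟩, hS⟩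
    · rintro ⟨A, ⟨-, h0A⟩, hS⟩
      exact (mem_sEq_iff hS (zero_mem_box n)).1 h0A
  rw [hrepr]
  refine measure_biUnion_finset ?_ fun A _ => measurableSet_sEq n A
  intro A hA A' hA' hne
  simp only [Function.onFun]
  rw [Set.disjoint_left]
  intro ω h1 h2
  exact hne (sEq_eq (mem_scands.1 (Finset.mem_filter.1 hA).1)
    (mem_scands.1 (Finset.mem_filter.1 hA').1) h1 h2)

/-! ### Claim 5: `{𝒮 = A}` is determined by the bonds of `Λ_n` not inside `A` -/

/-- **Claim 5 (characterisation).** For `A ⊆ Λ_n ∖ ∂Λ_n`: `𝒮 = A` iff every bond of `E(Λ_n)` from `A` to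
`Λ_n ∖ A` is closed and every `v ∈ Λ_n ∖ A` is joined to `∂Λ_n` inside `Λ_n ∖ A`. -/
theorem sEq_iff {n : ℕ} {A : Finset (Vertex d)} (hA : A ⊆ intF d n) {ω : Config d} :
    ω ∈ SEq n A ↔ (∀ e ∈ cutBonds (box d n) (↑A), e ∉ ω) ∧
      ∀ v ∈ box d n, v ∉ A → ∃ z ∈ boundary d n, ConnIn (box d n \ ↑A) ω v z := by
  constructor
  · intro hS
    refine ⟨fun e he hω => ?_, fun v hv hvA => ?_⟩
    · obtain ⟨heB, ⟨u, hue, huA⟩, ⟨v, hve, hvA⟩⟩ := he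
      have hne : u ≠ v := fun h => hvA (h ▸ huA)
      have hsuv : e = s(u, v) := (Sym2.mem_and_mem_iff hne).1 ⟨hue, hve⟩
      have huB : u ∈ box d n := heB.2 u hue
      have hvB : v ∈ box d n := heB.2 v hve
      have hu : ¬ ToBdry n ω u := (mem_sEq_iff hS huB).1 huA
      have hv : ToBdry n ω v := by
        by_contra hcon
        exact hvA ((mem_sEq_iff hS hvB).2 hcon)
      obtain ⟨z, hz, hc⟩ := hv
      exact hu ⟨z, hz, connIn_trans (connIn_of_adj (hsuv ▸ hω) (hsuv ▸ heB.1) huB hvB) hc⟩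
    · have hv' : ToBdry n ω v := by
        by_contra hcon
        exact hvA ((mem_sEq_iff hS hv).2 hcon)
      obtain ⟨z, hz, ⟨w⟩⟩ := hv'
      have hzA : z ∉ (↑A : Set (Vertex d)) := fun hzA =>
        (mem_sEq_iff hS hz.1).1 (Finset.mem_coe.1 hzA) (toBdry_of_mem_boundary ω hz)
      have hzT : z ∈ box d n \ (↑A : Set (Vertex d)) := ⟨hz.1, hzA⟩
      rcases exists_exit hzT w with h | ⟨x, y, hxA, -, hadj, -, hc⟩
      · exact ⟨z, hz, h⟩
      · exfalso
        obtain ⟨⟨h1, h2, h3, h4⟩, -⟩ := inGraph_adj.1 hadj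
        have hx : ¬ ToBdry n ω x := (mem_sEq_iff hS h3).1 (Finset.mem_coe.1 hxA)
        exact hx ⟨z, hz, connIn_trans (connIn_of_adj h1 h2 h3 h4) (connIn_mono_set Set.sdiff_subset hc)⟩
  · rintro ⟨hcut, hconn⟩ x hx
    have hxB : x ∈ box d n := mem_boxF.1 hx
    constructor
    · intro hnot
      by_contra hxA
      obtain ⟨z, hz, hc⟩ := hconn x hxB hxA
      exact hnot ⟨z, hz, connIn_mono_set Set.sdiff_subset hc⟩
    · intro hxA
      rintro ⟨z, hz, ⟨w⟩⟩
      have hzA : z ∉ (↑A : Set (Vertex d)) := fun hzA =>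
        (mem_intF.1 (hA (Finset.mem_coe.1 hzA))).2 hz
      have hzT : z ∈ box d n \ (↑A : Set (Vertex d)) := ⟨hz.1, hzA⟩
      rcases exists_exit hzT w with h | ⟨a, b, haA, hbA, hadj, -, -⟩
      · exact (mem_diff_of_connIn_diff hzT h).2 (Finset.mem_coe.2 hxA)
      · obtain ⟨⟨h1, h2, h3, h4⟩, -⟩ := inGraph_adj.1 hadj
        exact hcut s(a, b) ⟨⟨h2, fun v hv => by rcases Sym2.mem_iff.1 hv with rfl | rfl <;> assumption⟩,
          ⟨a, Sym2.mem_mk_left a b, haA⟩, ⟨b, Sym2.mem_mk_right a b, hbA⟩⟩ h1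

/-- Bonds of `E(Λ_n)` from `A` to `Λ_n ∖ A` are not inside `A`. -/
theorem cutBonds_subset_diff (n : ℕ) (A : Set (Vertex d)) :
    cutBonds (box d n) A ⊆ bondsIn (box d n) \ bondsIn A := by
  rintro e ⟨heB, -, v, hve, hvA⟩
  exact ⟨heB, fun h => hvA (h.2 v hve)⟩

/-- Bonds of `E(Λ_n ∖ A)` are bonds of `Λ_n` not inside `A`. -/
theorem bondsIn_diff_subset_diff (n : ℕ) (A : Set (Vertex d)) :
    bondsIn (box d n \ A) ⊆ bondsIn (box d n) \ bondsIn A := by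
  rintro e ⟨heb, hv⟩
  refine ⟨⟨heb, fun v hv' => (hv v hv').1⟩, fun h => ?_⟩
  induction e using Sym2.ind with
  | h a b => exact (hv a (Sym2.mem_mk_left a b)).2 (h.2 a (Sym2.mem_mk_left a b))

/-- **Claim 5.** `{𝒮 = A}` is determined by the bonds of `Λ_n` not inside `A` (`A ⊆ Λ_n ∖ ∂Λ_n`). -/
theorem determinedBy_sEq {n : ℕ} {A : Finset (Vertex d)} (hA : A ⊆ intF d n) :
    DeterminedBy (bondsIn (box d n) \ bondsIn (↑A)) (SEq n A) := by
  intro ω ω' h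
  rw [sEq_iff hA, sEq_iff hA]
  apply and_congr
  · exact forall₂_congr fun e he => not_congr (h e (cutBonds_subset_diff n _ he))
  · refine forall₂_congr fun v _ => imp_congr_right fun _ => exists_congr fun z =>
      and_congr_right fun _ => ?_
    exact connIn_congr (fun e he => h e (bondsIn_diff_subset_diff n _ he)) v z

end Summit.Ventures.PercRepro0.Sharp
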